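import Summits.Parity.GeneralizedHardyLittlewood.Theorems.LeeYangFibresAbsoluteUpgradeUniformMediumCollisionsAux
import Summits.Parity.GeneralizedHardyLittlewood.Theorems.LeeYangFibresAbsoluteUpgradeUniformMediumCollisionsAux2
import HarnessLib

/-!
# Route `LeeYangFibres`, crux `AbsoluteUpgrade` (stmt-Parity-14116), line `Sketch` (uniform amplification):
# the registered stub `stub_mediumCollisions` (D1 = `MediumCollisions`)

We prove `CondLocalAverage → MediumCollisions` (vocabulary `Theorems/LeeYangFibresAbsoluteUpgradeUniformDefs.lean`):
for a non-negative `2`-Lipschitz weight `w` vanishing off the shift box `[-2N, 2N]^m`, `y = y_N = ⌊log N/4⌋`,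
`F(H) = ∏_{p ≤ y} β_p(Ψ^{(H)})`, `F₀ = ∏_{p ≤ y} β_p(Ψ)`, `T = (m+1)t ≤ (log log N)^A`,

`∑_{H nondeg} w(H) F(H) ∑_{∅ ≠ Q ⊆ primes(y,x], ∏Q ≤ √N} ∏_{p∈Q} cc(H,p)/(p − T) ≤ η F₀^{m+1} (∑_{box} w + N^m N^{3/4})`.

Proof (Gallagher's averaging of the collision primes, uniform in `m`):
* every summand is `≥ 0` (`p > y > T`), so the sum extends to the whole shift box; swap the sums over `H` and `Q`;
* for one `Q` (part 1, `sum_shiftBox_prod_collisionCount_le`): expand `∏_{p∈Q} cc(H,p)` over the `≤ T^{2#Q}`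
  assignments of a linear congruence to each `p ∈ Q`; for one assignment the joint average of `F` and the
  congruence indicators over a cube of side `primorial(y)∏Q ≤ N^{0.35}√N ≤ N` is EXACT (`CondLocalAverage`), and the
  landed cube lemma `shiftBox_sum_mul_sub_le` gives `≤ F₀^{m+1} W_box/∏Q + 4m 7^m primorial(y) N^m F₀^{m+1}`;
* summing over `Q` with the weights `∏(p−T)⁻¹` (part 2): the main part is
  `F₀^{m+1} W_box (∏_{p>y}(1 + T²/(p(p−T))) − 1) ≤ F₀^{m+1} W_box · 4T²/y ≤ (η/2) F₀^{m+1} W_box` (`y ≥ 8T²/η`), the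
  error part is `4m 7^m primorial(y) N^m F₀^{m+1} ∏_{p ≤ √N}(1 + T²/(p−T)) ≤ 4m 7^m primorial(y) e^{2T²(log log N+4)} N^m F₀^{m+1}
  ≤ (η/2) N^{3/4} N^m F₀^{m+1}` (Mertens and the junk inequality `eventually_junk_le`).

References: P. X. Gallagher, Mathematika 23 (1976), §2 [Gallagher1976]; B. Green, T. Tao, Ann. of Math. 171
(2010), Lemma 1.3 [GreenTao2010]; Hardy–Wright Thm 427 [HardyWright2008].
-/

noncomputable section

open scoped BigOperators Classical Topology
open Finset Filter MeasureTheory Literature.NumberTheory.Sieve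
open Summit.Parity.GeneralizedHardyLittlewood.Cruxes.RelativeDimOne.TranslateAmplification

namespace Summit.Parity.GeneralizedHardyLittlewood.Cruxes.AbsoluteUpgrade.UniformAmplification

open CellParityLaw.SectionAnnihilator.SingularRatio (singularProductPartial_nonneg)

/-- The thresholds of the proof, uniform in `T ≤ (log log N)^A`: `y_N ≥ L`, `y_N ≥ 3T`, `y_N ≥ 2T²`,
`y_N ≥ 8T²/η`, `N ≥ e^4`, `N ≥ 16`, and the junk inequality. [folklore] -/
theorem mediumCollisions_thresholds (L A : ℕ) {η : ℝ} (hη : 0 < η) :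
    ∀ᶠ N : ℕ in atTop, (L : ℝ) ≤ truncLevel N ∧
      (∀ T : ℕ, (T : ℝ) ≤ Real.log (Real.log N) ^ A →
        3 * (T : ℝ) ≤ truncLevel N ∧ 2 * (T : ℝ) ^ 2 ≤ truncLevel N ∧
          8 / η * (T : ℝ) ^ 2 ≤ truncLevel N) ∧
      Real.exp 4 ≤ (N : ℝ) ∧ 16 ≤ N ∧
      (∀ m T : ℕ, (m : ℝ) ≤ T → (T : ℝ) ≤ Real.log (Real.log N) ^ A →
        4 * (m : ℝ) * 7 ^ m * primorial (truncLevel N) *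
            Real.exp (2 * (T : ℝ) ^ 2 * (Real.log (Real.log N) + 4)) ≤ η / 2 * (N : ℝ) ^ (3 / 4 : ℝ)) := by
  filter_upwards [eventually_mul_loglog_pow_le_truncLevel 0 L, eventually_mul_pow_le_truncLevel A 1 3,
    eventually_mul_pow_le_truncLevel A 2 2, eventually_mul_pow_le_truncLevel A 2 (8 / η),
    tendsto_natCast_atTop_atTop.eventually_ge_atTop (Real.exp 4), eventually_ge_atTop 16,
    eventually_junk_le A η hη] with N h1 h2 h3 h4 h5 h6 h7
  exact ⟨by simpa using h1, fun T hT => ⟨by simpa using h2 T hT, h3 T hT, h4 T hT⟩, h5, h6, h7⟩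

/-- `primorial(y_N) · q ≤ N` for every `q ≤ √N` (`primorial(y_N) ≤ N^{7/20} ≤ √N`), `N ≥ 1`. [folklore] -/
theorem primorial_mul_le_of_le_sqrt {N q : ℕ} (hN : 1 ≤ N) (hq : q ≤ Nat.sqrt N) :
    primorial (truncLevel N) * q ≤ N := by
  have hN0 : (0 : ℝ) ≤ N := Nat.cast_nonneg N
  have hP : ((primorial (truncLevel N) : ℕ) : ℝ) ≤ Real.sqrt N := by
    calc ((primorial (truncLevel N) : ℕ) : ℝ) ≤ (N : ℝ) ^ (7 / 20 : ℝ) := primorial_truncLevel_le_rpow' hN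
      _ ≤ (N : ℝ) ^ (1 / 2 : ℝ) := Real.rpow_le_rpow_of_exponent_le (by exact_mod_cast hN) (by norm_num)
      _ = Real.sqrt N := (Real.sqrt_eq_rpow N).symm
  have hq' : (q : ℝ) ≤ Real.sqrt N := by
    refine Real.le_sqrt_of_sq_le ?_
    exact_mod_cast (Nat.pow_le_pow_left hq 2).trans (Nat.sqrt_le' N)
  have h : ((primorial (truncLevel N) * q : ℕ) : ℝ) ≤ N := by
    rw [Nat.cast_mul]
    calc ((primorial (truncLevel N) : ℕ) : ℝ) * q ≤ Real.sqrt N * Real.sqrt N :=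
          mul_le_mul hP hq' (Nat.cast_nonneg q) (Real.sqrt_nonneg _)
      _ = N := Real.mul_self_sqrt hN0
  exact_mod_cast h

/-- **`stub_mediumCollisions`** (registered stub D1 of the line `Sketch`): the contribution of the square-free
collision moduli `∏Q ≤ √N` to Gallagher's m-uniform singular-series average, assuming the exact conditional
local averages `CondLocalAverage`. [cite: Gallagher1976, Section 2] -/
theorem stub_mediumCollisions : CondLocalAverage → MediumCollisions := by
  intro hB
  unfold MediumCollisions
  intro t L A ht η hη
  obtain ⟨N₀, hN₀⟩ := Filter.eventually_atTop.mp (mediumCollisions_thresholds L A hη)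
  refine ⟨N₀, fun N hN m hmT Ψ hΨ hL w hw hwlip hw0 x => ?_⟩
  obtain ⟨hLy, hTy, hN4, hN16, hjunk⟩ := hN₀ N hN
  obtain ⟨h3T, h2T2, h8T2⟩ := hTy ((m + 1) * t) hmT
  set y : ℕ := truncLevel N with hydef
  set T : ℕ := (m + 1) * t with hTdef
  set W : Finset ℕ := primeWindow y x with hWdef
  set QQ : Finset (Finset ℕ) := (W.powerset).filter (fun Q => Q.Nonempty ∧ ∏ p ∈ Q, p ≤ Nat.sqrt N)
    with hQQdef
  set F₀ : ℝ := singularProductPartial Ψ y with hF₀def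
  set Wb : ℝ := ∑ H ∈ shiftBox m N, w H with hWbdef
  set E : ℝ := 4 * (m : ℝ) * 7 ^ m * primorial y * (N : ℝ) ^ m * F₀ ^ (m + 1) with hEdef
  -- basic facts at `N`
  have hN1 : 1 ≤ N := le_trans (by norm_num) hN16
  have hN0 : (0 : ℝ) < N := by exact_mod_cast (by omega : 0 < N)
  have hy1 : 1 ≤ y := one_le_truncLevel hN4
  have hy0 : (0 : ℝ) < y := by exact_mod_cast hy1
  have hT1n : 1 ≤ T := Nat.mul_pos (Nat.succ_pos m) ht
  have hT1 : (1 : ℝ) ≤ T := by exact_mod_cast hT1n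
  have hT0 : (0 : ℝ) ≤ T := Nat.cast_nonneg T
  have hmT' : (m : ℝ) ≤ T := by
    have : m ≤ T := by rw [hTdef]; nlinarith
    exact_mod_cast this
  have h2T : 2 * (T : ℝ) ≤ y := by linarith
  have hLy' : L ≤ y := by exact_mod_cast hLy
  have hsqrt2 : 2 ≤ Nat.sqrt N := Nat.le_sqrt.mpr (by omega)
  have hF₀0 : 0 ≤ F₀ := singularProductPartial_nonneg _ _
  have hWb0 : 0 ≤ Wb := Finset.sum_nonneg fun H _ => hw H
  -- the primes of the window and the moduli
  have hWmem : ∀ p ∈ W, p.Prime ∧ y < p ∧ p ≤ x := fun p hp => by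
    rw [hWdef, primeWindow, Finset.mem_filter, Finset.mem_Ioc] at hp
    exact ⟨hp.2, hp.1.1, hp.1.2⟩
  have hWsub : W ⊆ Finset.Ioc y x := Finset.filter_subset _ _
  have hpT : ∀ p ∈ W, (T : ℝ) < p := fun p hp => by
    have h : (y : ℝ) < p := by exact_mod_cast (hWmem p hp).2.1
    linarith
  have hQQmem : ∀ Q ∈ QQ, Q ⊆ W ∧ Q.Nonempty ∧ ∏ p ∈ Q, p ≤ Nat.sqrt N := fun Q hQ => by
    rw [hQQdef, Finset.mem_filter, Finset.mem_powerset] at hQ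
    exact ⟨hQ.1, hQ.2.1, hQ.2.2⟩
  have hu0 : ∀ p ∈ W, 0 ≤ (T : ℝ) ^ 2 / ((p : ℝ) * ((p : ℝ) - T)) := fun p hp => by
    have h1 := hpT p hp
    have h2 : 0 < (p : ℝ) - T := by linarith
    positivity
  have hv0 : ∀ p ∈ W, 0 ≤ (T : ℝ) ^ 2 / ((p : ℝ) - T) := fun p hp => by
    have h1 := hpT p hp
    have h2 : 0 < (p : ℝ) - T := by linarith
    positivity
  -- Step 0: positivity, extension to the whole shift box
  have hinner0 : ∀ H : Fin m → ℤ,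
      0 ≤ ∑ Q ∈ QQ, ∏ p ∈ Q, (collisionCount Ψ H p : ℝ) / ((p : ℝ) - T) := fun H =>
    Finset.sum_nonneg fun Q hQ => Finset.prod_nonneg fun p hp =>
      div_nonneg (Nat.cast_nonneg _) (by linarith [hpT p ((hQQmem Q hQ).1 hp)])
  have hstep0 : ∑ H ∈ (shiftBox m N).filter (fun H => IsNondegenerateSystem (translateFamily Ψ H)),
        w H * singularProductPartial (translateFamily Ψ H) y *
          ∑ Q ∈ QQ, ∏ p ∈ Q, (collisionCount Ψ H p : ℝ) / ((p : ℝ) - T) ≤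
      ∑ H ∈ shiftBox m N, w H * singularProductPartial (translateFamily Ψ H) y *
          ∑ Q ∈ QQ, ∏ p ∈ Q, (collisionCount Ψ H p : ℝ) / ((p : ℝ) - T) :=
    Finset.sum_le_sum_of_subset_of_nonneg (Finset.filter_subset _ _) fun H _ _ =>
      mul_nonneg (mul_nonneg (hw H) (singularProductPartial_nonneg _ _)) (hinner0 H)
  -- Step 1: swap the sums, pull out the weights `∏ (p - T)⁻¹`
  have hswap : ∑ H ∈ shiftBox m N, w H * singularProductPartial (translateFamily Ψ H) y *
          ∑ Q ∈ QQ, ∏ p ∈ Q, (collisionCount Ψ H p : ℝ) / ((p : ℝ) - T) =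
      ∑ Q ∈ QQ, (∏ p ∈ Q, ((p : ℝ) - T)⁻¹) *
        ∑ H ∈ shiftBox m N, w H * singularProductPartial (translateFamily Ψ H) y *
          ∏ p ∈ Q, (collisionCount Ψ H p : ℝ) := by
    calc ∑ H ∈ shiftBox m N, w H * singularProductPartial (translateFamily Ψ H) y *
            ∑ Q ∈ QQ, ∏ p ∈ Q, (collisionCount Ψ H p : ℝ) / ((p : ℝ) - T)
        = ∑ H ∈ shiftBox m N, ∑ Q ∈ QQ, w H * singularProductPartial (translateFamily Ψ H) y *
            ∏ p ∈ Q, (collisionCount Ψ H p : ℝ) / ((p : ℝ) - T) := by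
          refine Finset.sum_congr rfl fun H _ => ?_
          rw [Finset.mul_sum]
      _ = ∑ Q ∈ QQ, ∑ H ∈ shiftBox m N, w H * singularProductPartial (translateFamily Ψ H) y *
            ∏ p ∈ Q, (collisionCount Ψ H p : ℝ) / ((p : ℝ) - T) := Finset.sum_comm
      _ = ∑ Q ∈ QQ, (∏ p ∈ Q, ((p : ℝ) - T)⁻¹) *
            ∑ H ∈ shiftBox m N, w H * singularProductPartial (translateFamily Ψ H) y *
              ∏ p ∈ Q, (collisionCount Ψ H p : ℝ) := by
          refine Finset.sum_congr rfl fun Q _ => ?_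
          rw [Finset.mul_sum]
          refine Finset.sum_congr rfl fun H _ => ?_
          rw [Finset.prod_div_distrib, Finset.prod_inv_distrib]
          ring
  -- Steps 2–4: the bound for one modulus (part 1)
  have haux : ∀ Q ∈ QQ, ∑ H ∈ shiftBox m N, w H * singularProductPartial (translateFamily Ψ H) y *
        ∏ p ∈ Q, (collisionCount Ψ H p : ℝ) ≤
      (T : ℝ) ^ (2 * #Q) * (F₀ ^ (m + 1) / (∏ p ∈ Q, (p : ℝ)) * Wb + E) := by
    intro Q hQ
    obtain ⟨hQW, -, hQs⟩ := hQQmem Q hQ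
    have h := sum_shiftBox_prod_collisionCount_le m t N L y Ψ w Q hB ht hΨ hL hLy' hw hwlip hw0
      (fun p hp => (hWmem p (hQW hp)).1) (fun p hp => (hWmem p (hQW hp)).2.1)
      (primorial_mul_le_of_le_sqrt hN1 hQs)
    rw [hEdef]
    convert h using 2
  -- Step 5: distribute the weights and sum over the moduli (part 2)
  have hmain : ∑ Q ∈ QQ, ∏ p ∈ Q, (T : ℝ) ^ 2 / ((p : ℝ) * ((p : ℝ) - T)) ≤ η / 2 := by
    calc ∑ Q ∈ QQ, ∏ p ∈ Q, (T : ℝ) ^ 2 / ((p : ℝ) * ((p : ℝ) - T))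
        ≤ ∑ Q ∈ W.powerset.filter (fun Q => Q.Nonempty), ∏ p ∈ Q, (T : ℝ) ^ 2 / ((p : ℝ) * ((p : ℝ) - T)) :=
          Finset.sum_le_sum_of_subset_of_nonneg
            (fun Q hQ => by
              rw [hQQdef, Finset.mem_filter] at hQ
              exact Finset.mem_filter.mpr ⟨hQ.1, hQ.2.1⟩)
            (fun Q hQ _ => Finset.prod_nonneg fun p hp =>
              hu0 p (Finset.mem_powerset.mp (Finset.mem_filter.mp hQ).1 hp))
      _ ≤ 4 * (T : ℝ) ^ 2 / y := sum_powerset_nonempty_prod_le W hy1 hWsub h2T h2T2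
      _ = η / 2 * (8 / η * (T : ℝ) ^ 2) / y := by
          congr 1
          field_simp
          ring
      _ ≤ η / 2 * (y : ℝ) / y := by gcongr
      _ = η / 2 := by field_simp
  have herr : ∑ Q ∈ QQ, ∏ p ∈ Q, (T : ℝ) ^ 2 / ((p : ℝ) - T) ≤
      Real.exp (2 * (T : ℝ) ^ 2 * (Real.log (Real.log N) + 4)) := by
    calc ∑ Q ∈ QQ, ∏ p ∈ Q, (T : ℝ) ^ 2 / ((p : ℝ) - T)
        ≤ ∑ Q ∈ (W.filter (fun p => p ≤ Nat.sqrt N)).powerset, ∏ p ∈ Q, (T : ℝ) ^ 2 / ((p : ℝ) - T) :=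
          Finset.sum_le_sum_of_subset_of_nonneg
            (fun Q hQ => by
              obtain ⟨hQW, -, hQs⟩ := hQQmem Q hQ
              exact Finset.mem_powerset.mpr fun p hp => Finset.mem_filter.mpr
                ⟨hQW hp, le_of_prod_le (fun q hq => (hWmem q (hQW hq)).1) hQs hp⟩)
            (fun Q hQ _ => Finset.prod_nonneg fun p hp =>
              hv0 p (Finset.mem_filter.mp (Finset.mem_powerset.mp hQ hp)).1)
      _ ≤ Real.exp (2 * (T : ℝ) ^ 2 * (Real.log (Real.log N) + 4)) :=
          sum_powerset_prod_le_exp _ hT0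
            (fun p hp => by
              obtain ⟨hpW, hps⟩ := Finset.mem_filter.mp hp
              exact Nat.mem_primesLE.mpr ⟨hps, (hWmem p hpW).1⟩)
            (fun p hp => by
              have h := hpT p (Finset.mem_filter.mp hp).1
              have h' : (y : ℝ) < p := by exact_mod_cast (hWmem p (Finset.mem_filter.mp hp).1).2.1
              linarith)
            hsqrt2 (Nat.sqrt_le_self N)
  have herr2 : E * Real.exp (2 * (T : ℝ) ^ 2 * (Real.log (Real.log N) + 4)) ≤
      η / 2 * (N : ℝ) ^ (3 / 4 : ℝ) * ((N : ℝ) ^ m * F₀ ^ (m + 1)) := by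
    have hj := hjunk m T hmT' hmT
    calc E * Real.exp (2 * (T : ℝ) ^ 2 * (Real.log (Real.log N) + 4))
        = 4 * (m : ℝ) * 7 ^ m * primorial y * Real.exp (2 * (T : ℝ) ^ 2 * (Real.log (Real.log N) + 4)) *
            ((N : ℝ) ^ m * F₀ ^ (m + 1)) := by rw [hEdef]; ring
      _ ≤ η / 2 * (N : ℝ) ^ (3 / 4 : ℝ) * ((N : ℝ) ^ m * F₀ ^ (m + 1)) :=
          mul_le_mul_of_nonneg_right hj (by positivity)
  have hE0 : 0 ≤ E := by positivity
  have hFW0 : 0 ≤ F₀ ^ (m + 1) * Wb := by positivity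
  -- Step 6: assemble
  calc ∑ H ∈ (shiftBox m N).filter (fun H => IsNondegenerateSystem (translateFamily Ψ H)),
        w H * singularProductPartial (translateFamily Ψ H) y *
          ∑ Q ∈ QQ, ∏ p ∈ Q, (collisionCount Ψ H p : ℝ) / ((p : ℝ) - T)
      ≤ ∑ H ∈ shiftBox m N, w H * singularProductPartial (translateFamily Ψ H) y *
          ∑ Q ∈ QQ, ∏ p ∈ Q, (collisionCount Ψ H p : ℝ) / ((p : ℝ) - T) := hstep0
    _ = ∑ Q ∈ QQ, (∏ p ∈ Q, ((p : ℝ) - T)⁻¹) *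
          ∑ H ∈ shiftBox m N, w H * singularProductPartial (translateFamily Ψ H) y *
            ∏ p ∈ Q, (collisionCount Ψ H p : ℝ) := hswap
    _ ≤ ∑ Q ∈ QQ, (∏ p ∈ Q, ((p : ℝ) - T)⁻¹) *
          ((T : ℝ) ^ (2 * #Q) * (F₀ ^ (m + 1) / (∏ p ∈ Q, (p : ℝ)) * Wb + E)) := by
        refine Finset.sum_le_sum fun Q hQ => mul_le_mul_of_nonneg_left (haux Q hQ) ?_
        exact Finset.prod_nonneg fun p hp => by
          have h := hpT p ((hQQmem Q hQ).1 hp)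
          have h2 : 0 < (p : ℝ) - T := by linarith
          positivity
    _ = ∑ Q ∈ QQ, (F₀ ^ (m + 1) * Wb * ∏ p ∈ Q, (T : ℝ) ^ 2 / ((p : ℝ) * ((p : ℝ) - T)) +
          E * ∏ p ∈ Q, (T : ℝ) ^ 2 / ((p : ℝ) - T)) := by
        refine Finset.sum_congr rfl fun Q hQ => weights_mul_bound_eq Q T _ Wb E
          (fun p hp => hpT p ((hQQmem Q hQ).1 hp)) fun p hp => ?_
        exact_mod_cast (hWmem p ((hQQmem Q hQ).1 hp)).1.pos
    _ = F₀ ^ (m + 1) * Wb * ∑ Q ∈ QQ, ∏ p ∈ Q, (T : ℝ) ^ 2 / ((p : ℝ) * ((p : ℝ) - T)) +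
          E * ∑ Q ∈ QQ, ∏ p ∈ Q, (T : ℝ) ^ 2 / ((p : ℝ) - T) := by
        rw [Finset.sum_add_distrib, ← Finset.mul_sum, ← Finset.mul_sum]
    _ ≤ F₀ ^ (m + 1) * Wb * (η / 2) + η / 2 * (N : ℝ) ^ (3 / 4 : ℝ) * ((N : ℝ) ^ m * F₀ ^ (m + 1)) :=
        add_le_add (mul_le_mul_of_nonneg_left hmain hFW0) ((mul_le_mul_of_nonneg_left herr hE0).trans herr2)
    _ = η * F₀ ^ (m + 1) * (Wb + (N : ℝ) ^ m * (N : ℝ) ^ (3 / 4 : ℝ)) -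
          (η / 2 * (F₀ ^ (m + 1) * Wb) + η / 2 * (F₀ ^ (m + 1) * ((N : ℝ) ^ m * (N : ℝ) ^ (3 / 4 : ℝ)))) := by
        ring
    _ ≤ η * F₀ ^ (m + 1) * (Wb + (N : ℝ) ^ m * (N : ℝ) ^ (3 / 4 : ℝ)) := sub_le_self _ (by positivity)

end Summit.Parity.GeneralizedHardyLittlewood.Cruxes.AbsoluteUpgrade.UniformAmplification

end
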